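import Literature.AlgebraicTopology.SingularHomology.CupRightMayerVietoris
import Literature.AlgebraicTopology.SingularHomology.GysinMapSupportProofs
import HarnessLib

/-!
# The action `⌣ β` on `H^*_X(W)` is the cup product on the subspace `↥W`

Topic `Literature/AlgebraicTopology/SingularHomology`. A. Hatcher, *Algebraic Topology* (2002),
§3.1 p. 197 (cochains "can be viewed as functions from singular simplices"), p. 199 ("`i*`
restricts a cochain"), §3.2 Prop. 3.10 (naturality of the cup product): under the tree's
comparison `H^p_X(W; 𝑹) ≅ H^p(↥W; R)` (`subsetCochains.homologyIsoSingularCohomology`,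
`isoSingularCochainComplex`, cochains of `W` computed in `C(X)` versus singular cochains of the
subspace) the right action `⌣ β` of a global cocycle `β ∈ Zᵈ(X; R)` on `H^*_X(W)`
(`SimplexSpan.cupRightH`, `CupRightMayerVietoris.lean`) becomes the honest cup product on `↥W`
with the pull-back of the class of `β`.  This lets the `H*(X)`-linear Mayer–Vietoris machinery of
`H^*_X` be fed with classes and identities of the ordinary cohomology ring (Husemoller,
*Fibre Bundles*, Ch. 17 §1 Thm. 1.1: the Leray–Hirsch comparison maps are built from `p*` and the
cup product with global classes).

PROVED here:
* `subsetCochains.isoSingularCochainComplex_hom_f_apply` — chain level: a cochain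
  `ψ ∈ Hom(C_X(W)ₖ, 𝑹)` goes to the function cochain `τ ↦ ψ(val ∘ τ)` of `↥W`;
* `subsetCochains.isoSingularCochainComplex_hom_f_cupRight` — `ψ ⌣ β ↦ (image of ψ) ⌣ val^♯ β`;
* `subsetCochains.homologyIsoSingularCohomology_hom_cupRightH` — **on cohomology,
  `iso (y ⌣ β) = iso y ⌣ val^*[β]`**, the cup product of the tree (`cupProduct`) on `↥W` with the
  restriction of the class `[β] ∈ Hᵈ(X; R)`.

Everything is proved; no named facts.

## References

* [HatcherAT2002] A. Hatcher, *Algebraic Topology*, CUP 2002, §3.1 pp. 197, 199; §3.2 Prop. 3.10.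
* [HusemollerFibreBundles1994] D. Husemoller, *Fibre Bundles*, 3rd ed. (1994), Ch. 17 §1 Thm. 1.1.
-/

noncomputable section

-- as in `CechCapBridge` / `GysinMapSupportProofs`: chains of the concrete complex are `Finsupp`s
-- up to unfolding of semireducible definitions
set_option backward.isDefEq.respectTransparency false

open CategoryTheory Limits

universe u v

namespace Literature.AlgebraicTopology.SingularHomology

namespace subsetCochains

variable {R : Type v} [CommRing R] {X : Type u} [TopologicalSpace X]

/-- Local notation: the coefficient object `ULift R` of `ModuleCat.{max u v} R`. -/
local notation "𝑹" => SimplexSpan.coefR R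

/-- The inclusion of the subspace `↥W → X`. [folklore] -/
abbrev valMap (W : Set X) : C(↥W, X) := ⟨Subtype.val, continuous_subtype_val⟩

/-- A simplex of the subspace, pushed to `X`, has image in `W`. [folklore] -/
lemma range_map_valMap_subset {W : Set X} {k : ℕ} (τ : SingularSimplex (↥W) k) :
    (SingularSimplex.map (valMap W) τ).range ⊆ W := by
  rw [SingularSimplex.range_map]
  rintro _ ⟨x, _, rfl⟩
  exact x.2

/-- **Chain level: `Hom(C_X(W), 𝑹) ≅ C^•(↥W; R)` sends `ψ` to the function cochain `τ ↦ ψ(val ∘ τ)`**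
(Hatcher 2002, §3.1 p. 197). [cite: HatcherAT2002, §3.1 p. 197] -/
theorem isoSingularCochainComplex_hom_f_apply (W : Set X) {k : ℕ} (ψ : (subsetCochains R 𝑹 W).X k) :
    (isoSingularCochainComplex R W).hom.f k ψ =
      fun τ : SingularSimplex (↥W) k ↦ (SimplexSpan.ofSet (R := R) W).toFun ψ
        (SingularSimplex.map (valMap W) τ) := by
  simp only [isoSingularCochainComplex, Iso.trans_hom, Iso.symm_hom, HomologicalComplex.comp_f,
    ModuleCat.comp_apply, singularCochainComplex.cochainIso, HomologicalComplex.Hom.isoOfComponents_inv_f]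
  -- cancel `XIso⁻¹` and compare morphisms `C_k(↥W) ⟶ ULift R` on elementary chains
  apply (ModuleCat.mono_iff_injective (singularCochainComplex.XIso R R (↥W) k).hom).mp inferInstance
  rw [← ModuleCat.comp_apply, Iso.inv_hom_id]
  change (dualMap R (ModuleCat.of R (ULift.{u} R)) (csingularChainComplex.compIso R R _).inv).f k
      ((dualMap R (ModuleCat.of R (ULift.{u} R)) (subspaceIso R R X W).hom).f k ψ) =
    singularCochainComplex.XIsoFun (R := R) (fun τ : SingularSimplex (↥W) k ↦
      (SimplexSpan.ofSet (R := R) W).toFun ψ (SingularSimplex.map (valMap W) τ))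
  rw [dualMap_f_apply, dualMap_f_apply]
  refine singularChainComplex.hom_ext fun τ r => ?_
  rw [ModuleCat.comp_apply, ModuleCat.comp_apply, compIso_inv_f_single, singularCochainComplex.XIsoFun_single]
  have hval : Subtype.val ((subspaceIso R R X W).hom.f k (Finsupp.single τ r)) =
      Finsupp.single (SingularSimplex.map (valMap W) τ) r := by
    change Subtype.val ((((chainsInSub R R X W).lift _ (map_val_mem_chainsInSub R R W)).f k
      (Finsupp.single τ r))) = _
    rw [Subcomplex.lift_f_apply_val, csingularChainComplex.map_f_single]
  have hmem : SingularSimplex.map (valMap W) τ ∈ (SimplexSpan.ofSet (R := R) W).carrier k :=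
    range_map_valMap_subset τ
  have helem : (subspaceIso R R X W).hom.f k (Finsupp.single τ r) =
      r • (⟨Finsupp.single (SingularSimplex.map (valMap W) τ) 1, (SimplexSpan.ofSet (R := R) W).single_mem hmem 1⟩ :
        (chainsInSub R R X W).toComplex.X k) := by
    apply Subtype.ext
    rw [hval, Submodule.coe_smul, Finsupp.smul_single, smul_eq_mul, mul_one]
  rw [helem, map_smul, (SimplexSpan.ofSet (R := R) W).toFun_apply_of_mem ψ hmem]
  rfl

/-- **Chain level: `ψ ⌣ β ↦ (image of ψ) ⌣ val^♯ β`** — the comparison takes the right action of the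
global cochain `β` to the Alexander–Whitney product on `↥W` with the pulled-back cochain (faces
commute with `val`, Hatcher 2002, proof of Prop. 3.10). [cite: HatcherAT2002, §3.2 Prop. 3.10] -/
theorem isoSingularCochainComplex_hom_f_cupRight (W : Set X) {p d n : ℕ} (h : p + d = n)
    (β : SingularSimplex X d → R) (ψ : (subsetCochains R 𝑹 W).X p) :
    (isoSingularCochainComplex R W).hom.f n ((SimplexSpan.ofSet (R := R) W).cupRight β h ψ) =
      cochainCup h ((isoSingularCochainComplex R W).hom.f p ψ)
        ((singularCochainComplex.map R R (valMap W)).f d β) := by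
  rw [isoSingularCochainComplex_hom_f_apply, isoSingularCochainComplex_hom_f_apply]
  funext τ
  rw [(SimplexSpan.ofSet (R := R) W).toFun_cupRight_eq β h ψ (range_map_valMap_subset τ),
    cochainCup_apply, singularCochainComplex.map_apply, SingularSimplex.frontFace_map,
    SingularSimplex.backFace_map]

/-- The class `[β] ∈ Hᵈ(X; R)` of a singular cocycle given as a function cochain. [folklore] -/
def clsOfCocycle {d : ℕ} (β : SingularSimplex X d → R)
    (hβ : (singularCochainComplex R R X).d d (d + 1) β = 0) : singularCohomology R R X d :=
  homologyCls (K := singularCochainComplex R R X) β (by rw [up_next]; exact hβ)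

/-- **On cohomology, `iso (y ⌣ β) = iso y ⌣ val^*[β]`**: under `H^*_X(W; 𝑹) ≅ H^*(↥W; R)` the action
`⌣ β` of a global cocycle is the cup product with the restriction of its class to the subspace
(Hatcher 2002, §3.2 Prop. 3.10; Husemoller Ch. 17 §1, the comparison maps `p*(c) ⌣ a`).
[cite: HatcherAT2002, §3.2 Prop. 3.10] [cite: HusemollerFibreBundles1994, Ch. 17 §1 Thm. 1.1] -/
theorem homologyIsoSingularCohomology_hom_cupRightH {W : Set X} {p d n : ℕ} (h : p + d = n)
    (β : SingularSimplex X d → R) (hβ : (singularCochainComplex R R X).d d (d + 1) β = 0)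
    (y : (subsetCochains R 𝑹 W).homology p) :
    (homologyIsoSingularCohomology R W n).hom
        ((SimplexSpan.ofSet (R := R) W).cupRightH (SimplexSpan.frontBackClosed_ofSet _) β hβ h y) =
      cupProduct h ((homologyIsoSingularCohomology R W p).hom y)
        (singularCohomology.map R R (valMap W) d (clsOfCocycle β hβ)) := by
  obtain ⟨ψ, hψ, rfl⟩ := homologyCls_surjective y
  rw [(SimplexSpan.ofSet (R := R) W).cupRightH_homologyCls]
  -- the three classes pushed to the singular cochain complex of `↥W`
  have hd₁ : (singularCochainComplex R R (↥W)).d n ((ComplexShape.up ℕ).next n)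
      ((isoSingularCochainComplex R W).hom.f n ((SimplexSpan.ofSet (R := R) W).cupRight β h ψ)) = 0 :=
    d_hom_f_eq_zero (isoSingularCochainComplex R W).hom _
      ((SimplexSpan.ofSet (R := R) W).d_next_cupRight_eq_zero (SimplexSpan.frontBackClosed_ofSet _) β hβ h ψ hψ)
  have hd₂ : (singularCochainComplex R R (↥W)).d p ((ComplexShape.up ℕ).next p)
      ((isoSingularCochainComplex R W).hom.f p ψ) = 0 :=
    d_hom_f_eq_zero (isoSingularCochainComplex R W).hom _ hψ
  have hβ' : (singularCochainComplex R R X).d d ((ComplexShape.up ℕ).next d) β = 0 := by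
    rw [up_next]; exact hβ
  have hd₃ : (singularCochainComplex R R (↥W)).d d ((ComplexShape.up ℕ).next d)
      ((singularCochainComplex.map R R (valMap W)).f d β) = 0 :=
    d_hom_f_eq_zero (singularCochainComplex.map R R (valMap W)) β hβ'
  have eL : (homologyIsoSingularCohomology R W n).hom
      (homologyCls ((SimplexSpan.ofSet (R := R) W).cupRight β h ψ)
        ((SimplexSpan.ofSet (R := R) W).d_next_cupRight_eq_zero (SimplexSpan.frontBackClosed_ofSet _)
          β hβ h ψ hψ)) =
      homologyCls (K := singularCochainComplex R R (↥W))
        ((isoSingularCochainComplex R W).hom.f n ((SimplexSpan.ofSet (R := R) W).cupRight β h ψ)) hd₁ :=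
    homologyMap_homologyCls (isoSingularCochainComplex R W).hom _ _
  have eP : (homologyIsoSingularCohomology R W p).hom (homologyCls ψ hψ) =
      homologyCls (K := singularCochainComplex R R (↥W)) ((isoSingularCochainComplex R W).hom.f p ψ) hd₂ :=
    homologyMap_homologyCls (isoSingularCochainComplex R W).hom _ _
  have eB : singularCohomology.map R R (valMap W) d (clsOfCocycle β hβ) =
      homologyCls (K := singularCochainComplex R R (↥W)) ((singularCochainComplex.map R R (valMap W)).f d β) hd₃ :=
    homologyMap_homologyCls (singularCochainComplex.map R R (valMap W)) β hβ'
  refine eL.trans ?_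
  rw [eP, eB]
  -- all three classes as `π (cocyclesMk …)`, then `cupProduct_π_π`
  have h1 : ∀ (k : ℕ) (φ : SingularSimplex (↥W) k → R)
      (hφ : (singularCochainComplex R R (↥W)).d k ((ComplexShape.up ℕ).next k) φ = 0),
      homologyCls (K := singularCochainComplex R R (↥W)) φ hφ =
        singularCohomology.π R R (↥W) k (singularCochainComplex.cocyclesMk φ
          ((d_next_eq_zero_iff (K := singularCochainComplex R R (↥W)) (up_next k) φ).1 hφ)) :=
    fun k φ hφ ↦ by
      rw [homologyCls_eq_homologyπ_cyclesMk _ hφ ((ComplexShape.up ℕ).next k) rfl hφ]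
      rfl
  rw [h1 n _ hd₁, h1 p _ hd₂, h1 d _ hd₃, cupProduct_π_π]
  congr 1
  apply (ModuleCat.mono_iff_injective (singularCochainComplex.iCocycles R R (↥W) n)).mp inferInstance
  rw [singularCochainComplex.iCocycles_mk, singularCochainComplex.iCocycles_cocyclesCup,
    singularCochainComplex.iCocycles_mk, singularCochainComplex.iCocycles_mk]
  exact isoSingularCochainComplex_hom_f_cupRight W h β ψ

end subsetCochains

end Literature.AlgebraicTopology.SingularHomology
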